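import Literature.AlgebraicGeometry.Hu2025.Proofs.S03Pluecker.GammaQuadNotIntegral
import HarnessLib

/-!
# Hu 2025 — the complete quadrilateral: a point of the typed Γ-scheme whose vanishing chart coordinates are EXACTLY `Γ`
# (the matroid side of the J1 / HU-R01 instance, on the row-101 chart; companion of `GammaQuadNotIntegral.lean`)

**HONEST FRAMING (D-0012/D-0089).** [Hu2025] is an unrefereed preprint under adjudication; nothing of it is asserted. This file is about
OUR typed objects (row 101): it exhibits, for every commutative ring `k` of characteristic `0`, a ring homomorphism
`k[x_u]_{u ∈ 𝕀_{3,9} ∖ m} → k` (a `k`-point of the chart `𝕌`) that kills the Γ-ideal `(𝓕_m) + (x̄_u : u ∈ Γ)` of the complete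
quadrilateral `Γ = {456, 478, 579, 689}` (so the point lies on `Z_Γ`, Def 7.1) and sends `x̄_u ↦ 0` EXACTLY for `u ∈ Γ` — i.e. the
point lies in the matroid Schubert cell `{x̄_u = 0, u ∈ Γ} ∩ {x̄_u ≠ 0, u ∉ Γ}` of `𝕌` (Prop 9.1's `Gr_d` with `Γ_d ∖ {bases} = Γ`,
chunk p0072 l.71). The point is the tree certificate's configuration `Q` (`Hu2025/GammaSchemeNotIntegral.lean`, `vanishing_Q` — the
frame `e₁,e₂,e₃` and the six vertices of the quadrilateral with normals `(−2,−2,2), (−1,2,−3), (−2,3,−2), (2,−2,1)`) transcribed to the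
typed basic variables `x_{23j} = a_{1j}`, `x_{13j} = −a_{2j}`, `x_{12j} = a_{3j}`. Together with `not_isDomain_gammaChart_quad` this types
BOTH halves of the J1 counter-configuration that live on the chart: «`Z_Γ` not integral» and «`Γ` is the set of vanishing Plücker
coordinates of a point of `𝕌 ∩ Gr`» (that the cell's quotient `X = Gr_d/T` is an integral scheme remains the certificate's prose).
AI proof is weaker than expert review; nothing here is progress on resolution of singularities.

## Method
`minorZ T u` is the INTEGER mirror of `chartMinor u` at a table `T` (the closed forms `chartMinor_12a/13a/23a/1bc/2bc/3bc` and
`chartMinor_explicit` of rows 101b / `GammaQuadNotIntegral`); `evalAt_chartMinor` proves `evalAt T (chartMinor u) = minorZ T u` for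
`u ∈ 𝕀_{3,n} ∖ m`; the 83 integer values at `Q` are then checked by `decide` (`minorZ_quadPointQexact_eq_zero_iff`).
-/

noncomputable section

namespace Literature.AlgebraicGeometry.Hu2025.Statements.S03Pluecker

open MvPolynomial

universe u

variable (k : Type u) [CommRing k]

/-- **Integer mirror of `chartMinor u` at a table `T`** (`u = (a,b,c)` increasing, `≠ (1,2,3)`): the closed forms of the minors of
`[I₃ | A]` by shape — `(12c), (13c), (23c)` a single basic variable; `(1bc), (2bc), (3bc)` a `2 × 2` expression; `(abc)`, `a > 3`, the
full cofactor expansion. Plumbing.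
[cite: Hu2025, Def. 7.1 (Z_Γ) p.128 and Prop. 9.1 (Γ_d, Gr_d); joint J1 = GAP-LEDGER-HU row HU-R01 (unrefereed preprint arXiv:2507.21400v1 under adjudication, D-0012/D-0089
— kernel support on OUR typed carriers of row 101; nothing of the source asserted)] -/
def minorZ (T : ℕ × ℕ × ℕ → ℤ) (u : ℕ × ℕ × ℕ) : ℤ :=
  if u.1 = 1 ∧ u.2.1 = 2 then T (1, 2, u.2.2)
  else if u.1 = 1 ∧ u.2.1 = 3 then T (1, 3, u.2.2)
  else if u.1 = 2 ∧ u.2.1 = 3 then T (2, 3, u.2.2)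
  else if u.1 = 1 then T (1, 2, u.2.1) * T (1, 3, u.2.2) - T (1, 3, u.2.1) * T (1, 2, u.2.2)
  else if u.1 = 2 then T (1, 2, u.2.1) * T (2, 3, u.2.2) - T (2, 3, u.2.1) * T (1, 2, u.2.2)
  else if u.1 = 3 then T (1, 3, u.2.1) * T (2, 3, u.2.2) - T (2, 3, u.2.1) * T (1, 3, u.2.2)
  else T (1, 2, u.1) * (T (1, 3, u.2.1) * T (2, 3, u.2.2) - T (2, 3, u.2.1) * T (1, 3, u.2.2))
    - T (1, 3, u.1) * (T (1, 2, u.2.1) * T (2, 3, u.2.2) - T (2, 3, u.2.1) * T (1, 2, u.2.2))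
    + T (2, 3, u.1) * (T (1, 2, u.2.1) * T (1, 3, u.2.2) - T (1, 3, u.2.1) * T (1, 2, u.2.2))

variable {n : ℕ}

/-- **`evalAt T (chartMinor u) = minorZ T u`** for every chart index `u ∈ 𝕀_{3,n} ∖ m` (seven shape cases).
[cite: Hu2025, Def. 7.1 (Z_Γ) p.128 and Prop. 9.1 (Γ_d, Gr_d); joint J1 = GAP-LEDGER-HU row HU-R01 (unrefereed preprint arXiv:2507.21400v1 under adjudication, D-0012/D-0089
— kernel support on OUR typed carriers of row 101; nothing of the source asserted)] -/
theorem evalAt_chartMinor (T : ℕ × ℕ × ℕ → ℤ) {u : ℕ × ℕ × ℕ} (hu : u ∈ plVarSet n) :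
    evalAt k n T (chartMinor k u) = (minorZ T u : k) := by
  obtain ⟨a, b, c⟩ := u
  have hne : (a, b, c) ≠ mTri := (Finset.mem_erase.mp hu).1
  have hidx := mem_plIndexSet_iff.mp (Finset.mem_erase.mp hu).2
  simp only at hidx
  obtain ⟨⟨ha1, han⟩, ⟨⟨hb1, hbn⟩, ⟨hc1, hcn⟩⟩, hab, hbc⟩ := hidx
  have hc3 : 3 < c := by
    by_contra h
    apply hne
    unfold mTri
    simp only [Prod.mk.injEq]
    omega
  unfold minorZ
  simp only
  rcases Nat.lt_or_ge 3 a with ha | ha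
  · -- `a, b, c > 3`: full expansion
    rw [chartMinor_explicit k ha (by omega) (by omega)]
    rw [if_neg (by omega), if_neg (by omega), if_neg (by omega), if_neg (by omega), if_neg (by omega), if_neg (by omega)]
    simp (disch := omega) only [map_add, map_sub, map_mul, evalAt_bvar]
    push_cast
    ring
  · rcases Nat.lt_or_ge 2 a with ha' | ha'
    · -- `a = 3 < b < c`
      obtain rfl : a = 3 := by omega
      rw [chartMinor_3bc k (by omega) (by omega)]
      rw [if_neg (by omega), if_neg (by omega), if_neg (by omega), if_neg (by omega), if_neg (by omega), if_pos rfl]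
      simp (disch := omega) only [map_sub, map_mul, evalAt_bvar]
      push_cast
      ring
    · rcases Nat.lt_or_ge 1 a with ha'' | ha''
      · -- `a = 2`
        obtain rfl : a = 2 := by omega
        rcases Nat.lt_or_ge 3 b with hb | hb
        · -- `(2, b, c)`, `b > 3`
          rw [chartMinor_2bc k hb (by omega)]
          rw [if_neg (by omega), if_neg (by omega), if_neg (by omega), if_neg (by omega), if_pos rfl]
          simp (disch := omega) only [map_sub, map_mul, evalAt_bvar]
          push_cast
          ring
        · -- `(2, 3, c)`
          obtain rfl : b = 3 := by omega
          rw [chartMinor_23a k hc3]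
          rw [if_neg (by omega), if_neg (by omega), if_pos ⟨rfl, rfl⟩]
          simp (disch := omega) only [evalAt_bvar]
      · -- `a = 1`
        obtain rfl : a = 1 := by omega
        rcases Nat.lt_or_ge 3 b with hb | hb
        · -- `(1, b, c)`, `b > 3`
          rw [chartMinor_1bc k hb (by omega)]
          rw [if_neg (by omega), if_neg (by omega), if_neg (by omega), if_pos rfl]
          simp (disch := omega) only [map_sub, map_mul, evalAt_bvar]
          push_cast
          ring
        · rcases Nat.lt_or_ge 2 b with hb' | hb'
          · -- `(1, 3, c)`
            obtain rfl : b = 3 := by omega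
            rw [chartMinor_13a k hc3]
            rw [if_neg (by omega), if_pos ⟨rfl, rfl⟩]
            simp (disch := omega) only [evalAt_bvar]
          · -- `(1, 2, c)`
            obtain rfl : b = 2 := by omega
            rw [chartMinor_12a k hc3]
            rw [if_pos ⟨rfl, rfl⟩]
            simp (disch := omega) only [evalAt_bvar]

/-- **The tree certificate's quadrilateral point `Q`, EXACT version** (`Hu2025/GammaSchemeNotIntegral.lean`, `Q`: `a₄ = (1,−4,−3)`,
`a₅ = (1,4,5)`, `a₆ = (1,3,4)`, `a₇ = (5,4,1)`, `a₈ = (4,5,2)`, `a₉ = (1,2,2)`; frame in general position), as the table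
`x_{23j} = a_{1j}`, `x_{13j} = −a_{2j}`, `x_{12j} = a_{3j}`. OURS.
[cite: Hu2025, Def. 7.1 (Z_Γ) p.128 and Prop. 9.1 (Γ_d, Gr_d); joint J1 = GAP-LEDGER-HU row HU-R01 (unrefereed preprint arXiv:2507.21400v1 under adjudication, D-0012/D-0089
— kernel support on OUR typed carriers of row 101; nothing of the source asserted)] -/
def quadPointQexact (t : ℕ × ℕ × ℕ) : ℤ :=
  if t = (1, 2, 4) then -3 else if t = (1, 2, 5) then 5 else if t = (1, 2, 6) then 4
  else if t = (1, 2, 7) then 1 else if t = (1, 2, 8) then 2 else if t = (1, 2, 9) then 2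
  else if t = (1, 3, 4) then 4 else if t = (1, 3, 5) then -4 else if t = (1, 3, 6) then -3
  else if t = (1, 3, 7) then -4 else if t = (1, 3, 8) then -5 else if t = (1, 3, 9) then -2
  else if t = (2, 3, 4) then 1 else if t = (2, 3, 5) then 1 else if t = (2, 3, 6) then 1
  else if t = (2, 3, 7) then 5 else if t = (2, 3, 8) then 4 else if t = (2, 3, 9) then 1 else 0

/-- `Γ` as a `Finset` (for `decide`).
[cite: Hu2025, Def. 7.1 (Z_Γ) p.128 and Prop. 9.1 (Γ_d, Gr_d); joint J1 = GAP-LEDGER-HU row HU-R01 (unrefereed preprint arXiv:2507.21400v1 under adjudication, D-0012/D-0089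
— kernel support on OUR typed carriers of row 101; nothing of the source asserted)] -/
def quadGammaFin : Finset (ℕ × ℕ × ℕ) := {(4, 5, 6), (4, 7, 8), (5, 7, 9), (6, 8, 9)}

/-- `quadGammaFin` is `quadGamma`.
[cite: Hu2025, Def. 7.1 (Z_Γ) p.128 and Prop. 9.1 (Γ_d, Gr_d); joint J1 = GAP-LEDGER-HU row HU-R01 (unrefereed preprint arXiv:2507.21400v1 under adjudication, D-0012/D-0089
— kernel support on OUR typed carriers of row 101; nothing of the source asserted)] -/
theorem mem_quadGammaFin_iff (u : ℕ × ℕ × ℕ) : u ∈ quadGammaFin ↔ u ∈ quadGamma := by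
  simp only [quadGammaFin, quadGamma, Finset.mem_insert, Finset.mem_singleton, Set.mem_insert_iff, Set.mem_singleton_iff]

/-- **Exactly the four quadrilateral minors vanish at `Q`** among the 83 chart coordinates (integer computation, `decide`; = the
tree's `vanishing_Q`, 0-based there).
[cite: Hu2025, Def. 7.1 (Z_Γ) p.128 and Prop. 9.1 (Γ_d, Gr_d); joint J1 = GAP-LEDGER-HU row HU-R01 (unrefereed preprint arXiv:2507.21400v1 under adjudication, D-0012/D-0089
— kernel support on OUR typed carriers of row 101; nothing of the source asserted)] -/
theorem minorZ_quadPointQexact_eq_zero_iff :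
    ∀ u ∈ plVarSet 9, minorZ quadPointQexact u = 0 ↔ u ∈ quadGammaFin := by
  decide +kernel

/-- **At the `k`-point `Q` of the chart (`k` of characteristic `0`), `x̄_u(Q) = 0` iff `u ∈ Γ`**, for every `u ∈ 𝕀_{3,9} ∖ m`.
[cite: Hu2025, Def. 7.1 (Z_Γ) p.128 and Prop. 9.1 (Γ_d, Gr_d); joint J1 = GAP-LEDGER-HU row HU-R01 (unrefereed preprint arXiv:2507.21400v1 under adjudication, D-0012/D-0089
— kernel support on OUR typed carriers of row 101; nothing of the source asserted)] -/
theorem evalQexact_chartMinor_eq_zero_iff [CharZero k] {u : ℕ × ℕ × ℕ} (hu : u ∈ plVarSet 9) :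
    evalAt k 9 quadPointQexact (chartMinor k u) = 0 ↔ u ∈ quadGamma := by
  rw [evalAt_chartMinor k quadPointQexact hu, Int.cast_eq_zero, minorZ_quadPointQexact_eq_zero_iff u hu, mem_quadGammaFin_iff]

/-- **A `k`-point of the typed Γ-scheme of the complete quadrilateral whose vanishing chart coordinates are EXACTLY `Γ`** (`k` any
commutative ring of characteristic `0`): the ring homomorphism `φ_Q = evalAt Q ∘ chartParam : k[x_u]_{u ∈ 𝕀_{3,9} ∖ m} → k` kills
`(𝓕_m) + (x̄_u : u ∈ Γ)` (so `Q ∈ Z_Γ`, Def 7.1) and has `φ_Q(x̄_u) = 0 ↔ u ∈ Γ` for all `u ∈ 𝕀_{3,9} ∖ m` (so `Q` lies in the matroid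
Schubert cell with non-bases `Γ` off the frame, Prop 9.1).
[cite: Hu2025, Def. 7.1 (Z_Γ) p.128 and Prop. 9.1 (Γ_d, Gr_d); joint J1 = GAP-LEDGER-HU row HU-R01 (unrefereed preprint arXiv:2507.21400v1 under adjudication, D-0012/D-0089
— kernel support on OUR typed carriers of row 101; nothing of the source asserted)] -/
theorem exists_point_gammaChart_quad_vanishing_iff [CharZero k] :
    ∃ φ : ChartRing 9 k →+* k, (∀ F ∈ gammaChartIdeal k 9 quadGamma, φ F = 0) ∧
      ∀ u ∈ plVarSet 9, φ (xbar k u) = 0 ↔ u ∈ quadGamma := by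
  refine ⟨(evalAt k 9 quadPointQexact).comp (chartParam 9 k).toRingHom, ?_, ?_⟩
  · intro F hF
    rw [mem_gammaChartIdeal_iff k (quadGamma_subset le_rfl)] at hF
    have hle : gammaMinorIdeal k 9 quadGamma ≤ RingHom.ker (evalAt k 9 quadPointQexact) := by
      unfold gammaMinorIdeal
      rw [Ideal.span_le]
      rintro _ ⟨u, hu, rfl⟩
      rw [SetLike.mem_coe, RingHom.mem_ker,
        evalQexact_chartMinor_eq_zero_iff k (quadGamma_subset le_rfl hu)]
      exact hu
    exact RingHom.mem_ker.mp (hle hF)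
  · intro u hu
    rw [RingHom.comp_apply, AlgHom.toRingHom_eq_coe, RingHom.coe_coe, chartParam_xbar k hu]
    exact evalQexact_chartMinor_eq_zero_iff k hu

/-- **The J1 counter-configuration on the typed chart, packaged** (for the HU-R01 lead to cite as one decl): over any nontrivial commutative ring
`k` of characteristic `0` (e.g. any field of characteristic `0`, or `ℤ`), (i) the typed Γ-scheme of the complete quadrilateral has a `k`-point whose vanishing chart coordinates are EXACTLY
`Γ = {456, 478, 579, 689}` (so `Γ` is the set of non-bases off the frame of a realised rank-3 matroid on `[9]`, and that point lies in
its matroid Schubert cell, Prop. 9.1), and (ii) the coordinate ring `k[x_u]_{u ∈ 𝕀_{3,9} ∖ m} ⧸ ((𝓕_m) + (x̄_u : u ∈ Γ))` of that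
Γ-scheme is NOT a domain. What is NOT typed here: that the cell's torus quotient `X = Gr_d/T` is an integral scheme (the antecedent of the
inference «X integral ⇒ Z_Γ integral», [Hu22] p.131 l.40–41) — see the tree certificate's discussion.
[cite: Hu2025, Def. 7.1 (Z_Γ) p.128 and Prop. 9.1 (Γ_d, Gr_d); joint J1 = GAP-LEDGER-HU row HU-R01 (unrefereed preprint arXiv:2507.21400v1 under adjudication, D-0012/D-0089
— kernel support on OUR typed carriers of row 101; nothing of the source asserted)] -/
theorem quad_counter_configuration [Nontrivial k] [CharZero k] :
    (∃ φ : ChartRing 9 k →+* k, (∀ F ∈ gammaChartIdeal k 9 quadGamma, φ F = 0) ∧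
        ∀ u ∈ plVarSet 9, φ (xbar k u) = 0 ↔ u ∈ quadGamma) ∧
      ¬ IsDomain (ChartRing 9 k ⧸ gammaChartIdeal k 9 quadGamma) :=
  ⟨exists_point_gammaChart_quad_vanishing_iff k, not_isDomain_gammaChart_quad_nine k⟩

end Literature.AlgebraicGeometry.Hu2025.Statements.S03Pluecker

end
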